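import Literature.AlgebraicGeometry.HodgeTheory.WeilSurfaceSquareSymmetries
import Literature.AlgebraicGeometry.HodgeTheory.CrossProductTopClass
import Literature.AlgebraicGeometry.HodgeTheory.TopDegreeClasses
import Literature.AlgebraicGeometry.HodgeTheory.MotivatedClassesAlgebraic
import Literature.AlgebraicGeometry.HodgeTheory.HardLefschetzThreefold
import Literature.AlgebraicGeometry.Motives.ComplexPointsOrientation
import HarnessLib

/-!
# The Weil classes of the companion surface `E × E` are ALGEBRAIC, with non-zero self-intersection

Continuation of `WeilClassesSurfacesProofs` (the companion Weil surface `B = E_τ × E_τ`,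
`ψ = ((0, -d), (1, 0))`, discharge of `exists_weilType_abelianSurfaces`) and
`WeilSurfaceSquareSymmetries`. Schoen (Compositio 114 (1998), §10, proof of the Proposition) uses
that on his partner surface "`W_{A'}` is generated by cohomology classes of divisors"; for the
companion surface this file PROVES the analogous statement on the tree's real carriers, with no
appeal to Lefschetz `(1,1)` or to the Hodge index theorem:

* `WeilSquare.weilDivisorClass τ d = pr₁^* ω - d · pr₂^* ω` (`ω ≠ 0` a rational top class of `E`) is
  a RATIONAL, ALGEBRAIC (`mem_algebraicClasses_of_degree_top`, `map_fst/snd_mem_supportedClasses`) class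
  of `H²((E × E)(ℂ); ℂ)` — on `E × E` it is `[o × E] - d [E × o]`;
* **it spans, with its `(𝟙 + ψ)^*`-partner, the Weil plane**: pulled back to the torus it is
  `κ · e[dx₀ ∧ dx₁ - d · dx₂ ∧ dx₃] = κ' (e[α_{i√d}] + e[α_{-i√d}])` (`exists_pullbackHom_fstClass_sndClass`:
  `φ^*(pr₁^* ω)` is fixed by the sign changes of the second block, hence a multiple of `e[dx₀ ∧ dx₁]`,
  and the swap carries `pr₁^* ω` to `pr₂^* ω` and `e[dx₀ ∧ dx₁]` to `e[dx₂ ∧ dx₃]` with the SAME scalar);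
* hence it is of Hodge type `(1,1)`, lies in `weilClassesOf B ψ 1 d`, and
* **`(pr₁^* ω - d pr₂^* ω)² = -2d · pr₁^* ω ∪ pr₂^* ω ≠ 0`** (`ω ∪ ω = 0` in `H⁴(E(ℂ)) = 0`;
  `cupProduct_map_fst_map_snd_ne_zero`) — `cupProduct_weilDivisorClass_self_ne_zero`;
* `exists_weilType_abelianSurfaces_algebraic` — the packaged existence statement: a Weil-type abelian
  surface for `ℚ(√-d)` whose rational `(1,1)` Weil class `b` is algebraic with `b ∪ b ≠ 0` (exactly the
  input of Schoen's transfer `pr_{A*}((pr_A^* w ∪ pr_B^* b_±) ∪ pr_B^* b)`).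

Everything is proved; no named fact is introduced.

## References

* C. Schoen, Compositio Math. 114 (1998), §10. [Schoen1998HodgeWeilAddendum]
* B. van Geemen, LNM 1594 (1994), 5.2–5.3. [vanGeemen1994HodgeAV]
* C. Voisin, *Hodge Theory and Complex Algebraic Geometry II* (2003), proof of Prop. 9.21 (i). [VoisinHodgeII2003]
* W. Fulton, *Young Tableaux* (1997), Appendix B §B.1 (6). [FultonYoungTableaux1997]
-/

noncomputable section

open CategoryTheory MonoidalCategory CartesianMonoidalCategory
open scoped Manifold ContDiff ComplexConjugate
open Literature.AlgebraicGeometry.Motives Literature.Geometry.Kaehler Literature.NumberTheory.Transcendental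
open Literature.AlgebraicTopology.SingularHomology
open Literature.Barriers.HodgeConjecture (signedPermMatrix)

namespace Literature.AlgebraicGeometry.HodgeTheory

namespace WeilSquare

/-! ### The divisor class `pr₁^* ω - d · pr₂^* ω` -/

section Divisor

variable (τ : ℂ) (hτ : τ.im ≠ 0)

/-- The orientation family used for the Gysin maps (any choice). [folklore] -/
def orient : OrientationFamily := fun _ _ h ↦ Classical.choice (Motives.ComplexPoints.isOrientableOver ℂ h)

/-- **A non-zero rational top class `ω` of `E`** (chosen). [cite: HatcherAT2002, §3.3] -/
def topClass : complexBetti (curveAV τ hτ).X (2 * 1) :=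
  (exists_isRationalClass_top_ne_zero orient (periodPair τ hτ).curve.isSmoothProjective_scheme).choose

/-- `ω ≠ 0`. [folklore] -/
theorem topClass_ne_zero : topClass τ hτ ≠ 0 :=
  (exists_isRationalClass_top_ne_zero orient (periodPair τ hτ).curve.isSmoothProjective_scheme).choose_spec.1

/-- `ω` is rational. [folklore] -/
theorem isRationalClass_topClass : IsRationalClass (topClass τ hτ) :=
  (exists_isRationalClass_top_ne_zero orient (periodPair τ hτ).curve.isSmoothProjective_scheme).choose_spec.2

/-- `pr₁^* ω`. [folklore] -/
def fstClass : complexBetti (square τ hτ).X 2 :=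
  complexBetti.map (fstAV τ hτ).hom.hom.hom (2 * 1) (topClass τ hτ)

/-- `pr₂^* ω`. [folklore] -/
def sndClass : complexBetti (square τ hτ).X 2 :=
  complexBetti.map (sndAV τ hτ).hom.hom.hom (2 * 1) (topClass τ hτ)

/-- **The divisor class `pr₁^* ω - d · pr₂^* ω`** (on `E × E`: a multiple of `[o × E] - d [E × o]`).
[cite: Schoen1998HodgeWeilAddendum, §10] -/
def weilDivisorClass (d : ℕ) : complexBetti (square τ hτ).X 2 := fstClass τ hτ - (d : ℂ) • sndClass τ hτ

/-- `pr₁^* ω - d pr₂^* ω` is rational. [cite: HatcherAT2002, §3.1] -/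
theorem isRationalClass_weilDivisorClass (d : ℕ) : IsRationalClass (weilDivisorClass τ hτ d) := by
  have h1 : IsRationalClass (fstClass τ hτ) := (isRationalClass_topClass τ hτ).map _
  have h2 : IsRationalClass (sndClass τ hτ) := (isRationalClass_topClass τ hτ).map _
  have e : weilDivisorClass τ hτ d = fstClass τ hτ + (((-(d : ℤ) : ℤ) : ℚ) : ℂ) • sndClass τ hτ := by
    rw [weilDivisorClass, Rat.cast_intCast, Int.cast_neg, Int.cast_natCast, neg_smul, sub_eq_add_neg]
  rw [e]
  exact h1.add (h2.smul _)

/-- **`pr₁^* ω - d pr₂^* ω` is ALGEBRAIC**: `ω` is of top degree on the curve `E`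
(`mem_algebraicClasses_of_degree_top`) and pull-backs along the two projections respect the support
filtration. [cite: VoisinHodgeII2003, proof of Prop. 9.21 (i)] -/
theorem weilDivisorClass_mem_algebraicClasses (d : ℕ) : weilDivisorClass τ hτ d ∈ algebraicClasses (square τ hτ).X 1 := by
  have hE := (periodPair τ hτ).curve.isSmoothProjective_scheme
  have hω : topClass τ hτ ∈ algebraicClasses (curveAV τ hτ).X 1 :=
    mem_algebraicClasses_of_degree_top hE le_rfl _
  refine Submodule.sub_mem _ ?_ (Submodule.smul_mem _ _ ?_)
  · exact map_fst_mem_supportedClasses hE hE hω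
  · exact map_snd_mem_supportedClasses hE hE hω

/-- **`(pr₁^* ω - d pr₂^* ω)² ≠ 0` for `d ≥ 1`**: `ω ∪ ω ∈ H⁴(E(ℂ)) = 0`, so the square is
`-2d · pr₁^* ω ∪ pr₂^* ω`, and the cross term is non-zero (`cupProduct_map_fst_map_snd_ne_zero`).
[cite: FultonYoungTableaux1997, Appendix B §B.1 (6)] -/
theorem cupProduct_weilDivisorClass_self_ne_zero {d : ℕ} (hd : 0 < d) :
    cupProduct (show 2 + 2 = 4 from rfl) (weilDivisorClass τ hτ d) (weilDivisorClass τ hτ d) ≠ 0 := by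
  have hE := (periodPair τ hτ).curve.isSmoothProjective_scheme
  set u₁ := fstClass τ hτ with hu₁
  set u₂ := sndClass τ hτ with hu₂
  -- `ω ∪ ω = 0`
  haveI : Subsingleton (complexBetti (curveAV τ hτ).X 4) := subsingleton_complexBetti hE (by norm_num)
  have hωω : cupProduct (show 2 * 1 + 2 * 1 = 4 from rfl) (topClass τ hτ) (topClass τ hτ) = 0 :=
    Subsingleton.elim _ _
  have h11 : cupProduct (show 2 + 2 = 4 from rfl) u₁ u₁ = 0 := by
    rw [hu₁, fstClass]
    change cupProduct (show 2 * 1 + 2 * 1 = 4 from rfl) (singularCohomology.map ℂ ℂ _ _ _)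
      (singularCohomology.map ℂ ℂ _ _ _) = 0
    rw [← cupProduct_map, hωω, map_zero]
  have h22 : cupProduct (show 2 + 2 = 4 from rfl) u₂ u₂ = 0 := by
    rw [hu₂, sndClass]
    change cupProduct (show 2 * 1 + 2 * 1 = 4 from rfl) (singularCohomology.map ℂ ℂ _ _ _)
      (singularCohomology.map ℂ ℂ _ _ _) = 0
    rw [← cupProduct_map, hωω, map_zero]
  have h21 : cupProduct (show 2 + 2 = 4 from rfl) u₂ u₁ = cupProduct (show 2 + 2 = 4 from rfl) u₁ u₂ := by
    rw [cupProduct_gradedComm_holds ℂ _ _ (show 2 + 2 = 4 from rfl)]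
    norm_num
  have h12 : cupProduct (show 2 + 2 = 4 from rfl) u₁ u₂ ≠ 0 :=
    cupProduct_map_fst_map_snd_ne_zero orient hE hE (show 2 * 1 + 2 * 1 = 4 from rfl) (topClass_ne_zero τ hτ)
      (topClass_ne_zero τ hτ)
  have hexp : cupProduct (show 2 + 2 = 4 from rfl) (weilDivisorClass τ hτ d) (weilDivisorClass τ hτ d) =
      (-(2 * (d : ℂ))) • cupProduct (show 2 + 2 = 4 from rfl) u₁ u₂ := by
    rw [weilDivisorClass, ← hu₁, ← hu₂]
    simp only [map_sub, map_smul, LinearMap.sub_apply, LinearMap.smul_apply, h11, h22, h21]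
    module
  rw [hexp]
  exact smul_ne_zero (neg_ne_zero.mpr (mul_ne_zero two_ne_zero (Nat.cast_ne_zero.mpr hd.ne'))) h12

variable {e : ComplexDeRhamIsoFamily (Fin 2 → ℂ)} (he : e.IsNatural)

/-- Pull-back to the torus of `f^* w` along a morphism `f` of `E × E` commuting with an automorphism
`g` of the torus through `torusMap`: `φ^* w' ` is `g^*`-fixed when `f(ℂ) ∘ φ ∘ g = f(ℂ) ∘ φ`. [folklore] -/
theorem torusPullback_pullbackHom_map_eq {Y : Motives.SchemeOver ℂ} (f : (square τ hτ).X ⟶ Y)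
    (A : Matrix (Fin 4) (Fin 4) ℤ)
    (hfg : ∀ t, AlgPoints.map f (torusMap τ hτ (ComplexTorus.mapMatrix (periodIso τ hτ) (periodIso τ hτ) A t)) =
      AlgPoints.map f (torusMap τ hτ t)) (w : complexBetti Y 2) :
    torusPullback τ hτ A (pullbackHom τ hτ (complexBetti.map f 2 w)) = pullbackHom τ hτ (complexBetti.map f 2 w) := by
  have hc : (AlgPoints.mapContinuous (L := ℂ) f).comp ((⟨torusMap τ hτ, (isHomeomorph_torusMap τ hτ).continuous⟩ : C(_, _)).comp
      (⟨ComplexTorus.mapMatrix (periodIso τ hτ) (periodIso τ hτ) A,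
        (ComplexTorus.contMDiff_real_mapMatrix (Φ := periodIso τ hτ) (Φ' := periodIso τ hτ) (n := ∞) A).continuous⟩ : C(_, _))) =
      (AlgPoints.mapContinuous (L := ℂ) f).comp ⟨torusMap τ hτ, (isHomeomorph_torusMap τ hτ).continuous⟩ := by
    refine ContinuousMap.ext fun t ↦ ?_
    simp only [ContinuousMap.comp_apply, ContinuousMap.coe_mk, AlgPoints.mapContinuous_apply]
    exact hfg t
  change (singularCohomology.map ℂ ℂ _ 2).hom ((singularCohomology.map ℂ ℂ _ 2).hom ((singularCohomology.map ℂ ℂ _ 2).hom w)) =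
    (singularCohomology.map ℂ ℂ _ 2).hom ((singularCohomology.map ℂ ℂ _ 2).hom w)
  rw [← LinearMap.comp_apply, ← ModuleCat.hom_comp, ← singularCohomology.map_comp,
    ← LinearMap.comp_apply, ← ModuleCat.hom_comp, ← singularCohomology.map_comp, hc,
    singularCohomology.map_comp, ModuleCat.hom_comp, LinearMap.comp_apply]

include he in
/-- **`φ^*(pr₁^* ω) = κ · e[dx₀ ∧ dx₁]` and `φ^*(pr₂^* ω) = κ · e[dx₂ ∧ dx₃]` with the SAME scalar `κ`**:
the first is fixed by the sign changes of the second block, the second is its image under the swap.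
[cite: LangeBirkenhake1992, §1.1.2 and §1.1.4] -/
theorem exists_pullbackHom_fstClass_sndClass :
    ∃ κ : ℂ, pullbackHom τ hτ (fstClass τ hτ) = κ • deRhamIso τ hτ e (ComplexTorus.cconstClass (periodIso τ hτ)
        (ComplexTorus.latMonomial (periodIso τ hτ) 2 ![0, 1])) ∧
      pullbackHom τ hτ (sndClass τ hτ) = κ • deRhamIso τ hτ e (ComplexTorus.cconstClass (periodIso τ hτ)
        (ComplexTorus.latMonomial (periodIso τ hτ) 2 ![2, 3])) := by
  obtain ⟨κ, hκ⟩ := exists_eq_smul_of_fixed_two_three τ hτ he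
    (torusPullback_pullbackHom_map_eq τ hτ _ _ (map_fst_torusMap_flip τ hτ 2 (Or.inl rfl)) (topClass τ hτ))
    (torusPullback_pullbackHom_map_eq τ hτ _ _ (map_fst_torusMap_flip τ hτ 3 (Or.inr rfl)) (topClass τ hτ))
  change pullbackHom τ hτ (fstClass τ hτ) = _ at hκ
  refine ⟨κ, hκ, ?_⟩
  -- the swap: `σ^* pr₁^* ω = pr₂^* ω` and `σ_T^* e[dx₀₁] = e[dx₂₃]`
  have hσ : complexBetti.map (swapAV τ hτ).hom.hom.hom 2 (fstClass τ hτ) = sndClass τ hτ := by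
    rw [fstClass, sndClass, ← swapAV_fst]
    change _ = singularCohomology.map ℂ ℂ
      (Motives.AlgPoints.mapContinuous (L := ℂ) ((swapAV τ hτ).hom.hom.hom ≫ (fstAV τ hτ).hom.hom.hom)) 2 (topClass τ hτ)
    rw [Motives.AlgPoints.mapContinuous_comp, singularCohomology.map_comp]
    rfl
  have hc : ((AlgPoints.mapContinuous (L := ℂ) (swapAV τ hτ).hom.hom.hom).comp
        (⟨torusMap τ hτ, (isHomeomorph_torusMap τ hτ).continuous⟩ : C(_, _))) =
      (⟨torusMap τ hτ, (isHomeomorph_torusMap τ hτ).continuous⟩ : C(_, _)).comp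
        ⟨ComplexTorus.mapMatrix (periodIso τ hτ) (periodIso τ hτ) (signedPermMatrix (fun _ ↦ (1 : ℤ)) swapPerm),
          (ComplexTorus.contMDiff_real_mapMatrix (Φ := periodIso τ hτ) (Φ' := periodIso τ hτ) (n := ∞)
            (signedPermMatrix (fun _ ↦ (1 : ℤ)) swapPerm)).continuous⟩ := by
    refine ContinuousMap.ext fun t ↦ ?_
    simp only [ContinuousMap.comp_apply, ContinuousMap.coe_mk, AlgPoints.mapContinuous_apply]
    exact (torusMap_swap τ hτ t).symm
  have h2 : pullbackHom τ hτ (sndClass τ hτ) =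
      torusPullback τ hτ (signedPermMatrix (fun _ ↦ (1 : ℤ)) swapPerm) (pullbackHom τ hτ (fstClass τ hτ)) := by
    rw [← hσ]
    change (singularCohomology.map ℂ ℂ _ 2).hom ((singularCohomology.map ℂ ℂ
      (AlgPoints.mapContinuous (L := ℂ) (swapAV τ hτ).hom.hom.hom) 2).hom (fstClass τ hτ)) = _
    rw [← LinearMap.comp_apply, ← ModuleCat.hom_comp, ← singularCohomology.map_comp, hc,
      singularCohomology.map_comp, torusPullback_apply]
    rfl
  rw [h2, hκ, map_smul, torusPullback_e_latMonomial τ hτ he, Finset.prod_const_one, Int.cast_one, one_smul]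
  obtain ⟨e0, e1, -, -⟩ := swapPerm_apply
  have hw : (swapPerm ∘ ![0, 1] : Fin 2 → Fin 4) = ![2, 3] := by
    funext i; fin_cases i <;> simp [e0, e1]
  rw [hw]

end Divisor

end WeilSquare

/-! ### The packaged existence statement -/

open WeilSquare in
/-- **A Weil-type abelian surface for `ℚ(√-d)` whose Weil class is an ALGEBRAIC divisor class with
non-zero square.** For every `d ≥ 1`: `B = E_i × E_i`, `ψ = ((0, -d), (1, 0))` (`ψ² = -d`) and
`b = pr₁^* ω - d · pr₂^* ω` (`ω ≠ 0` a rational top class of `E_i`): `b` is rational, of Hodge type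
`(1,1)`, lies in the Weil plane `weilClassesOf B ψ 1 d`, is ALGEBRAIC, and `b ∪ b ≠ 0` — Schoen's
"`W_{A'}` is generated by cohomology classes of divisors" together with the surjectivity of
`W ⊗ H² → H⁴` on his partner surface (Compositio 114 (1998), §10, p. 333), for the companion
surface, on the tree's carriers. Relies on: nothing unproved. [cite: Schoen1998HodgeWeilAddendum, §10 (proof of the Proposition, p. 333)]
[cite: vanGeemen1994HodgeAV, 5.2–5.3] -/
theorem exists_weilType_abelianSurfaces_algebraic :
    ∀ d : ℕ, 0 < d → ∃ (B : Motives.AbelianVariety ℂ) (ψ : B ⟶ B) (b : complexBetti B.X (2 * 1)),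
      B.dim = 2 ∧ ψ ≫ ψ = -(d • 𝟙 B) ∧ IsRationalClass b ∧
      IsOfHodgeType (2 * 1) B.X (2 * 1) 1 1 b ∧ b ∈ weilClassesOf B ψ 1 d ∧
      b ∈ algebraicClasses B.X 1 ∧ cupProduct (show 2 * 1 + 2 * 1 = 2 * (2 * 1) from rfl) b b ≠ 0 := by
  intro d hd
  have hτ : Complex.I.im ≠ 0 := by simp
  obtain ⟨e, he⟩ := exists_complexDeRhamIsoFamily_holds (Fin 2 → ℂ)
  set Φ := periodIso Complex.I hτ with hΦ
  -- `s = i√d`, `s² = -d`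
  set s : ℂ := Complex.I * (Real.sqrt d : ℂ) with hsdef
  have hsq : ((Real.sqrt d : ℝ) : ℂ) * (Real.sqrt d : ℂ) = (d : ℂ) := by
    rw [← Complex.ofReal_mul, Real.mul_self_sqrt (Nat.cast_nonneg d), Complex.ofReal_natCast]
  have hs : s * s = -(d : ℂ) := by
    rw [hsdef]; linear_combination ((Real.sqrt d : ℂ) * (Real.sqrt d : ℂ)) * Complex.I_mul_I - hsq
  have hs' : (-s) * (-s) = -(d : ℂ) := by rw [neg_mul_neg, hs]
  have hsZ : s * s = -((d : ℤ) : ℂ) := by rw [Int.cast_natCast]; exact hs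
  -- the classes on the torus
  set Ap := deRhamIso Complex.I hτ e (ComplexTorus.cconstClass Φ (weilForm s)) with hAp
  set Am := deRhamIso Complex.I hτ e (ComplexTorus.cconstClass Φ (weilForm (-s))) with hAm
  have hconj : conj Complex.I - Complex.I = -2 * Complex.I := by rw [Complex.conj_I]; ring
  set k : ℂ := (2 * (conj Complex.I - Complex.I))⁻¹ with hk
  have hk0 : 2 * (conj Complex.I - Complex.I) ≠ 0 := by
    rw [hconj]; exact mul_ne_zero two_ne_zero (mul_ne_zero (by norm_num) Complex.I_ne_zero)
  have hβk : ComplexTorus.latMonomial Φ 2 ![0, 1] - ((d : ℤ) : ℂ) • ComplexTorus.latMonomial Φ 2 ![2, 3] =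
      k • (weilForm s + weilForm (-s)) := by
    rw [weilForm_add_weilForm_neg Complex.I hτ (d : ℤ) hsZ, smul_smul, hk, inv_mul_cancel₀ hk0, one_smul]
  -- the divisor class and its pull-back to the torus
  set b := weilDivisorClass Complex.I hτ d with hb
  obtain ⟨κ, hκ₁, hκ₂⟩ := exists_pullbackHom_fstClass_sndClass Complex.I hτ he
  have e1 : pullbackHom Complex.I hτ b = κ • deRhamIso Complex.I hτ e (ComplexTorus.cconstClass Φ
      (ComplexTorus.latMonomial Φ 2 ![0, 1] - ((d : ℤ) : ℂ) • ComplexTorus.latMonomial Φ 2 ![2, 3])) := by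
    rw [hb, weilDivisorClass, map_sub, map_smul, hκ₁, hκ₂]
    simp only [map_sub, map_smul, Int.cast_natCast]
    module
  have hφb : pullbackHom Complex.I hτ b = (κ * k) • (Ap + Am) := by
    rw [e1, hβk, map_smul, map_add, map_smul, map_add, smul_smul]
  set bp := pullbackInv Complex.I hτ ((κ * k) • Ap) with hbp
  set bm := pullbackInv Complex.I hτ ((κ * k) • Am) with hbm
  have hbsum : b = bp + bm := by
    rw [hbp, hbm, ← map_add, ← smul_add, ← hφb, pullbackInv_pullbackHom]
  refine ⟨square Complex.I hτ, psi Complex.I hτ d, b, dim_square Complex.I hτ, psi_comp_psi Complex.I hτ d,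
    isRationalClass_weilDivisorClass Complex.I hτ d, ?_, ?_, weilDivisorClass_mem_algebraicClasses Complex.I hτ d,
    cupProduct_weilDivisorClass_self_ne_zero Complex.I hτ hd⟩
  · -- Hodge type `(1,1)` in the torus model
    refine ⟨hodgeModel Complex.I hτ e he, ?_⟩
    rw [hodgeModel_pullback, hφb]
    change (κ * k) • (Ap + Am) ∈ (hodgePQ (Fin 2 → ℂ) (Torus Complex.I hτ) 2 1 1).map (deRhamIso Complex.I hτ e).toLinearMap
    refine Submodule.smul_mem _ _ (Submodule.add_mem _ ?_ ?_)
    · exact Submodule.mem_map_of_mem (cconstClass_weilForm_mem_hodgePQ Complex.I hτ s)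
    · exact Submodule.mem_map_of_mem (cconstClass_weilForm_mem_hodgePQ Complex.I hτ (-s))
  · -- the Weil plane: `b = b₊ + b₋`
    rw [hbsum, weilClassesOf]
    refine Submodule.add_mem _ (Submodule.mem_sup_left ?_) (Submodule.mem_sup_right ?_)
    · rw [mem_weilClassesPlus_iff]
      intro x y
      have h := map_weilEnd_pullbackInv_weilFormClass Complex.I hτ he d x y hs (κ * k)
      have hev : ((x : ℂ) + y * s) ^ 2 = ((x : ℂ) + (y : ℂ) * Complex.I * (Real.sqrt d : ℂ)) ^ (2 * 1) := by
        rw [hsdef]; ring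
      rw [← hev]
      exact h
    · rw [mem_weilClassesMinus_iff]
      intro x y
      have h := map_weilEnd_pullbackInv_weilFormClass Complex.I hτ he d x y hs' (κ * k)
      have hev : ((x : ℂ) + y * (-s)) ^ 2 = ((x : ℂ) - (y : ℂ) * Complex.I * (Real.sqrt d : ℂ)) ^ (2 * 1) := by
        rw [hsdef]; ring
      rw [← hev]
      exact h

end Literature.AlgebraicGeometry.HodgeTheory

end
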